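import Summits.QuantumAdvantage.QuantumAdvantage.Theses.ArithStatLadder
import Summits.QuantumAdvantage.QuantumAdvantage.Theorems.ArithStatLadderIqThreeMemBQPStubMirrorDichotomy
import Summits.QuantumAdvantage.QuantumAdvantage.Theorems.ArithStatLadderIqThreeMemBQPStubFrontEnd
import Summits.QuantumAdvantage.QuantumAdvantage.Theorems.ArithStatLadderIqThreeMemBQPStubThreeOrdBit
import Summits.QuantumAdvantage.QuantumAdvantage.Theorems.ArithStatLadderIqThreeMemBQPStubImagWitnessOfBit
import Summits.QuantumAdvantage.QuantumAdvantage.Theorems.ArithStatLadderIqThreeMemBQPStubRealWitnessOfParts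
import Summits.QuantumAdvantage.QuantumAdvantage.Theorems.ArithStatLadderIqThreeMemBQPStubRedIdealsPerClass
import Summits.QuantumAdvantage.QuantumAdvantage.Theorems.ArithStatLadderIqThreeMemBQPStubGuardedOr
import Summits.QuantumAdvantage.QuantumAdvantage.Theorems.ArithStatLadderAvgFaceBeyondPriorMirrorTorsionImpThreeDvd
import Literature.NumberTheory.QuadraticFields.ScholzHeckeUnitCriterionProofs
import Literature.NumberTheory.QuadraticFields.ScholzHeckeUnitCriterionHolds
import Literature.Computability.Cryptography.HallgrenClassGroup
import Literature.Computability.Cryptography.HallgrenClassGroupDiscriminant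
import Literature.Computability.Cryptography.HallgrenClassGroupQuantumKernel
import Literature.Computability.Cryptography.HallgrenClassGroupAssembly
import Literature.Computability.Cryptography.HallgrenPell
import Literature.Computability.Cryptography.HallgrenPellHolds
import Literature.Computability.Cryptography.ClassBQPReductionProofs
import Literature.Computability.Cryptography.ShorAssemblyLeavesProofs
import Literature.Computability.QuantumComplexity.PromiseWrap
import Literature.NumberTheory.QuadraticFields.ThreeTorsion
import Literature.NumberTheory.QuadraticFields.ScholzReflection
import Literature.NumberTheory.QuadraticFields.ScholzHeckeUnitCriterion
import Literature.NumberTheory.QuadraticFields.RealQuadraticRegulator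
import Literature.NumberTheory.QuadraticFields.QuadraticDedekindZetaKronecker
import Mathlib.NumberTheory.NumberField.Units.Regulator

/-!
# Line `scholz-mirror-siegel` — skeleton for the crux `ArithStatLadder.IqThreeMemBQP`
(crux item stmt-QuantumAdvantage-2424, rank 3, route `route-QuantumAdvantage-ArithStatLadder`;
crux-plan generation 1 by planner `cruxplan-stmt-QuantumAdvantage-2424-scholz-mirror-siegel`;
**reshaped by the line lead `prover-line-stmt-QuantumAdvantage-2424-0` (2026-08-16, reshapes r1–r5; r3 = stub signatures over tree constants only, vocabulary kept for the composition; r4 = test T1 as a promise problem `(cubeYes, cubeNo)` guarded by `FUND`; r5 = S1, S3, S7 LANDED, S4 split into the debt stub S8 `stub_subgroupOrder` (= the Literature named fact `Hallgren2005.subgroupOrder_qsolvable`), S4a `stub_threeOrdBit` and S4b `stub_imagWitnessOfBit`, S6 split into S6a `stub_redIdealsPerClass` and S6b `stub_realWitnessOfParts`; r6 = S4a (p93669), S4b (p103495), S6a (p94752), S6b (p96937) LANDED and imported, S8 DISCHARGED by the tree theorem `Hallgren2005.subgroupOrder_qsolvable_holds` (HallgrenClassGroupAssembly, 2026-08-16)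 ; r7 = S7 LANDED (p106278 ACCEPTED; still a placeholder below only because its module is not yet built on the farm), S2 RESHAPED to the single classical implication the composition still lacks, S2′ `stub_threeDvdImpCube` (direction (ii) of the Scholz–Hecke criterion at trivial mirror torsion — byte-identical to stub 3 of crux stmt-QuantumAdvantage-2427's line `mirror-unit-signature`, in flight there), because S2(a) is now consumed only through the tree theorem `AvgFaceBeyondPrior.Mirror.stub_mirrorTorsionImpThreeDvd` (landed 13:29Z by that crux's lead; placeholder below until its module is built) and S2(b) is the tree theorem `ScholzHecke.cube_imp_three_dvd`; S5 FILED as the Literature named fact `Hallgren2007_idealClassOrder_qsolvable` (p106241 ACCEPTED) ; r8 = S2′ DISCHARGED by the tree theorem `ScholzHecke.three_dvd_imp_cube` (ScholzHeckeUnitCriterionHolds.lean, landed 14:03Z by a literature prover; also `ScholzHecke_unitCubeCriterion_holds`) ; r9 = all placeholders replaced by imports (modules built 16:45Z) and the def-free composition LANDED in the tree as `Theorems/ArithStatLadderIqThreeMemBQP.lean` (p115653, `IqThreeMemBQP_of_facts : Hallgren2007_idealClassOrder_qsolvable → IqThreeMemBQP`) — OPEN: S5 ONLY (named fact `Hallgren2007_idealClassOrder_qsolvable`,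 XL, sized ≈ 5.7 kLoC in the attached plan))**:
the hinge S2 and the mirror vocabulary are now stated VERBATIM over the two Literature named facts
`Scholz1932_reflection` (`QuadraticFields/ScholzReflection.lean`) and `ScholzHecke_unitCubeCriterion`
(`QuadraticFields/ScholzHeckeUnitCriterion.lean`: `mirrorRadicand`, `IsMirrorFundUnit`, `unitPow8`,
`UnitCubeAtThree`), so that the class-field-theory debt of this crux is EXACTLY those two facts (shared
with crux stmt-QuantumAdvantage-2427, line `mirror-unit-signature`); brightness is stated in RESIDUE form
(`NumberField.dedekindZeta_residue`, Mathlib's analytic class number formula), the currency both samplers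
and the Landau/caseA proof of S1 use; stub names and the composition shape are unchanged.)

Crux (FIXED, by name): `IqThreeMemBQP` = `IQ3 ∈ BQP` UNCONDITIONALLY, with
`IQ3 = bin {d : −d fundamental, 3 ∣ h(−d)}` (`h = BinaryQuadraticForm.classNumber`, LSB-first codes).

Idea ("Spiegelung beats Siegel"; crux idea card `scholz-mirror-siegel`, merged per the triage panel
r1-1/2/3 with `mirror-dodge` / `scholz-mirror-landau-page` (same lever) and with the engine
`torsion-witness-sampling`): the only obstruction to an unconditional quantum decision of `3 ∣ h(−d)`
is a Landau–Siegel zero of the input's OWN character `χ_{−d}` (every sampler reaching `Cl(−d)` has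
rate `≍ L(1, χ_{−d})`). But the route needs ONE BIT, `3 ∣ h(−d)`, and for `p = 3` Scholz's
reflection theorem (1932), refined by the unit defect (Kummer theory over `ℚ(√−d, √−3)`; Washington
GTM 83 Thm 10.10 and its proof; Hecke Satz 118–119), transports exactly this bit to the MIRROR field
`F = ℚ(√3d)` (discriminant `D⁺ = mirrorDisc d ∈ {3d, d/3}`):
`3 ∣ h(−d) ⟺ #Cl(F)[3] ≠ 1 ∨ ε_F is a cube at 3` (`UnitCubeAtThree d`, a congruence mod `9` on the
coordinates of the fundamental unit); and Landau's 1918 repulsion (PROVED in the tree: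
`DirichletZFR.exists_landau_prodChar_min_le`) + MV Thm 11.14 case A (PROVED: `Siegel.caseA`) say that
`χ_{−d}` and `χ_{D⁺}` are never BOTH dark. So the algorithm is the threshold-free MIRROR TRIPLE TEST:
accept `d` iff
  (T1) `ε_F` is a cube at `3` — computable on EVERY `d` from the PROVED tree facts
       `Hallgren2007_regulator_qsolvable_delim_holds` (GRH-free regulator) and
       `JacobsonWilliams2008_unitResidue_mem_FP_holds` (unit coordinates mod `9` from `⌊R⌉`), or
  (T2) a torsion witness in `Cl(−d)`: a near-uniform random class (ideal sampler) whose order is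
       divisible by `3` (one order computation in the form class group), or
  (T3) a torsion witness in `Cl(F)` (same sampler on the real side; order of ONE ideal class of a real
       quadratic field by Hallgren's `ℤ × ℝ` hidden-subgroup machinery, GRH-free at `k = 1`).
Soundness on every input: (T1) ⇒ `3 ∣ h(−d)` (Scholz–Hecke (i)); (T3) ⇒ `#Cl₃(D⁺) ≠ 1` ⇒
`#Cl₃(−d) ≥ #Cl₃(D⁺) > 1` (Scholz left); (T2) is direct. Completeness: `3 ∣ h(−d)` and not (T1) ⇒
`#Cl₃(D⁺) ≠ 1` (Scholz–Hecke (ii)), so BOTH class groups have 3-torsion, and by the mirror dichotomy one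
of the two fields is BRIGHT (`κ ≥ c/log d`), where its sampler finds a witness in polynomial time with
probability `≥ 2/3` (torsion statistic: in a finite abelian group with `3 ∣ |G|` a uniform element has
order divisible by `3` with probability `≥ 2/3`). No GRH, no Siegel, no generating set of any class group.

THE LINE after reshape r5 (7 registered OPEN stubs + 3 LANDED stubs, composed by `IqThreeMemBQP_of`, kernel-checked):
* LANDED `stub_mirrorDichotomy` (S1, p91050, `Theorems/ArithStatLadderIqThreeMemBQPStubMirrorDichotomy.lean`):
  `K = ℚ(√−d)` or its Scholz mirror `F` (discriminant `D⁺ = mirrorDisc d`) is bright, `κ ≥ c/log d`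
  (Landau repulsion + MV 11.14 case A + the class number formula in residue form; effective, no Siegel).
* `stub_reflectionDefect` (S2; THE HINGE; class field theory; DEBT): exactly the consequence of the Literature
  named facts `Scholz1932_reflection` (left inequality) and `ScholzHecke_unitCubeCriterion` — 3 lines the day
  their `…_holds` theorems land (debt shared with crux 2427).
* LANDED `stub_frontEnd` (S3, p89908, `Theorems/ArithStatLadderIqThreeMemBQPStubFrontEnd.lean`): `FUND ∈ BQP` and the
  unit-cube PROMISE problem `(cubeYes, cubeNo)` `∈ PromiseBQP`.
* `stub_subgroupOrder` (S8; DEBT): VERBATIM the Literature named fact `Hallgren2005.subgroupOrder_qsolvable`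
  (`HallgrenClassGroupAssembly.lean`: the order of the subgroup of the form class group `Cl(−d)` generated by a
  given list of reduced forms is `IsQSolvable`; unconditional Kitaev/Cheung–Mosca over the tree's kernel
  `kernelProb_clOrderEst_ge`; what is missing in the tree is the reversible block + uniformity + `FP` read-out).
* `stub_threeOrdBit` (S4a; M–L; PROVABLE NOW): S8 → the language
  `{encodeClInstance d [q] : IsClInstance d [q] ∧ 3 ∣ clGenOrder d [q]}` is in `BQP` (classical wrap of the
  S8 family: the instance checker, and the read-out of the order from a bare-prefix answer by classical
  VERIFICATION — among the `≤ |y| + 1` prefixes `n` of the measured string with `q^n ∼ 1` (fast exponentiation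
  by `composeGC`/`reduceGC`) the least is the order —, then `mem_BQP_of_isQSolvable_bit`).
* `stub_imagWitnessOfBit` (S4b; XL): S4a-conclusion → for every `c > 0` the promise problem (yes: `−d`
  fundamental, `3 ∣ h(−d)`, `κ_K ≥ c/log d`; no: `−d` fundamental, `3 ∤ h(−d)`) is in `PromiseBQP` — the
  imaginary ideal sampler as ONE `FP` machine with coins relative to the oracle `FACT ⊕ S4a`
  (`mem_PromiseBQP_of_FPRel_decider_oneSided`, p88536; counts p90034/p90551/p90790/p89062/p89080 landed by
  the S4 worker; reduction `imagWitness_of_sampler` in the S4 work file).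
* `stub_realIdealClassOrder` (S5; XL, HARDEST; DEBT-to-be): the order of ONE ideal class `[(a, r + √m)]` of a
  real quadratic field is quantum polynomial-time computable WITHOUT GRH, output SELF-DELIMITED (Hallgren 2007,
  the `k = 1` case of the `ℤ^k × ℝ` hidden subgroup problem behind the class-group theorem; GRH enters only
  through the generating set — Childs–van Dam 2010 §5.7); to be filed as a Literature named fact.
* `stub_redIdealsPerClass` (S6a; L; PROVABLE NOW, pure number theory): every ideal class of a real quadratic
  field contains `≥ R_F/log(2√d_F)` REDUCED ideals `[a, (b + √D)/2]` (cycle of a class: the product of the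
  `ψ_k = (b_k + √D)/(2a_k) < √D` over a period is a unit `> 1`, hence `≥ e^{R_F}`), stated in the S5 query
  format `span {fmtA, fmtR + α}`.
* `stub_realWitnessOfParts` (S6b; XL): S6a → S5 → for every `c > 0` the real-side promise problem (yes: `−d`
  fundamental, `d ≠ 3`, `#Cl₃(D⁺) ≠ 1`, `κ_F ≥ c/log d`; no: `−d` fundamental, `d ≠ 3`, `#Cl₃(D⁺) = 1`) is
  in `PromiseBQP` — the REDUCED-IDEAL sampler (Route B of the S6 worker: `b` uniform below `√D⁺`, factor
  `(D⁺ − b²)/4` by Shor, a uniformly random divisor `a`, keep reduced pairs, one order-bit query; no Landau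
  per-class count needed), divisor moment (R4), `VALID ∈ BQP`, `stub_guardedOr` for the order-bit language.
* LANDED `stub_guardedOr` (S7, `Theorems/ArithStatLadderIqThreeMemBQPStubGuardedOr.lean`, on the Literature
  infrastructure `JuxtaposedDeciders` p88571): the GENERIC guarded-OR closure of `BQP`/`PromiseBQP`.
* `iqThree_mem_BQP_of_parts` (PROVED here) and `IqThreeMemBQP_of` (concludes the crux BY NAME).

Disproof.lean (cdisprove cycles 1–2, READ 2026-08-16T05:45Z): no `_false_without_` theorem exists (the
crux has no hypothesis); §3 "load-bearing for TRUTH = poly(log d) generating set of `Cl(−d)`" — this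
line DENIES the load: no stub generates any class group; §4/§4bis refuted strengthening (prime forms of
norm `≤ log₂ d` generate; `no_small_form_547`) — not used anywhere; §6 (bare-prefix outputs are
ambiguous) — HONOURED: S5's relation is self-delimited (`boolPair`), S4/S6 are promise DECISION problems,
T1 is a language; §7(c) (one missing `BQP ∩ BQP` combinator) — is exactly S7, built on
`isQSolvable_of_generated_circuits` / `isQSolvable_classicalWrap_holds`; §0/§1 model facts: `[]` and
non-canonical words are outside `FUND`, so the guard rejects them (`hno` case `w ∉ G` of S7). Landed
Negative lemmas: `Theorems/IqThreeMemBQP/Negative/RefutationCost.lean` (imported; refutes no stub).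
-/

set_option linter.dupNamespace false
set_option linter.unusedVariables false

noncomputable section

open scoped NumberField nonZeroDivisors

namespace Summit.QuantumAdvantage.QuantumAdvantage.Cruxes.IqThreeMemBQP.ScholzMirrorSiegel

open _root_.Computability Literature.Computability.Complexity Literature.Computability.Cryptography
open Literature.NumberTheory.QuadraticFields
open Summit.QuantumAdvantage.QuantumAdvantage.Theses.ArithStatLadder (IqThreeMemBQP)

-- Short alias for the namespace of the LANDED stub theorems.
namespace StubThm
export Summit.QuantumAdvantage.QuantumAdvantage.Theorems.ArithStatLadder.IqThreeMemBQP
  (stub_mirrorDichotomy stub_frontEnd stub_threeOrdBit stub_imagWitnessOfBit stub_realWitnessOfParts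
    stub_redIdealsPerClass stub_guardedOr)
end StubThm


/-! ## Vocabulary (inlined notions of the line; all over existing declarations) -/

/-- The set `S = {d : −d fundamental, 3 ∣ h(−d)}` of the crux (`IsNegFundamentalDiscr` is verbatim the
route file's inline disjunction, so `iqThreeLang ∈ BQP` is the crux up to `δ`-unfolding). -/
def iqThreeSet : Set ℕ :=
  {d | IsNegFundamentalDiscr d ∧ 3 ∣ BinaryQuadraticForm.classNumber (-(d : ℤ))}

/-- The language `IQ3 = bin(S)` (image of Mathlib's `encodeNat`, LSB first). -/
def iqThreeLang : Language Bool :=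
  encodingNatBool.toLanguage iqThreeSet

/-- The crux is literally `IQ3 ∈ BQP` (definitional; cf. `Negative.RefutationCost.iqThreeMemBQP_iff`). -/
theorem iqThreeMemBQP_iff : IqThreeMemBQP ↔ iqThreeLang ∈ BQP := Iff.rfl

/-- The (fundamental) discriminant `D⁺ ∈ {d/3, 3d}` of the Scholz mirror field `F = ℚ(√3d)` — VERBATIM
the expression used by the Literature facts `Scholz1932_reflection` / `ScholzHecke_unitCubeCriterion`. -/
def mirrorDisc (d : ℕ) : ℤ := if 3 ∣ d then ((d / 3 : ℕ) : ℤ) else 3 * (d : ℤ)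

/-- **Brightness of `K = ℚ(√−d)` in residue form** (the set of `c`-bright `d`): every quadratic number
field of discriminant `−d` has `κ_K = Res_{s=1} ζ_K ≥ c / log d` (`κ_K = L(1, χ_{−d}) = 2πh(−d)/(w√d)`). -/
def brightNeg (c : ℝ) : Set ℕ :=
  {d | ∀ (K : Type) [Field K] [NumberField K], Module.finrank ℚ K = 2 →
    NumberField.discr K = -(d : ℤ) → c / Real.log d ≤ NumberField.dedekindZeta_residue K}

/-- **Brightness of the mirror `F` in residue form** (the set of `d` with `c`-bright mirror): every
quadratic number field of discriminant `D⁺ = mirrorDisc d` has `κ_F ≥ c / log d` (`κ_F = L(1, χ_{D⁺}) = 2 h_F R_F/√D⁺`). -/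
def brightPos (c : ℝ) : Set ℕ :=
  {d | ∀ (F : Type) [Field F] [NumberField F], Module.finrank ℚ F = 2 →
    NumberField.discr F = mirrorDisc d → c / Real.log d ≤ NumberField.dedekindZeta_residue F}

/-- The guard language `FUND = bin {d : −d is a fundamental discriminant}`. -/
def fundLang : Language Bool :=
  encodingNatBool.toLanguage {d | IsNegFundamentalDiscr d}

/-- Yes-instances of test T1 (a PROMISE problem on fundamental inputs): `−d` fundamental, `d ≠ 3`, and
the mirror unit `ε_F` is a cube at `3` (`UnitCubeAtThree` of `ScholzHeckeUnitCriterion.lean`: a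
congruence mod `9` on `(a + b√d₀)⁸`). -/
def cubeYes : Language Bool :=
  encodingNatBool.toLanguage {d | IsNegFundamentalDiscr d ∧ d ≠ 3 ∧ UnitCubeAtThree d}

/-- No-instances of test T1: `−d` fundamental, `d ≠ 3`, `ε_F` NOT a cube at `3`. (Off the promise —
`−d` not fundamental — the regulator / unit-residue subroutines are unconstrained, which is why T1 is a
promise problem guarded by `FUND` and not a language.) -/
def cubeNo : Language Bool :=
  encodingNatBool.toLanguage {d | IsNegFundamentalDiscr d ∧ d ≠ 3 ∧ ¬ UnitCubeAtThree d}

/-- Yes-instances of test T2 at brightness `c`: `−d` fundamental, `3 ∣ h(−d)`, `K` bright. -/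
def yesNeg (c : ℝ) : Language Bool :=
  encodingNatBool.toLanguage
    {d | IsNegFundamentalDiscr d ∧ 3 ∣ BinaryQuadraticForm.classNumber (-(d : ℤ)) ∧ d ∈ brightNeg c}

/-- No-instances of test T2 (brightness-free!): `−d` fundamental and `3 ∤ h(−d)` — there is no torsion
witness at all, so soundness holds on EVERY such input. -/
def noNeg : Language Bool :=
  encodingNatBool.toLanguage {d | IsNegFundamentalDiscr d ∧ ¬ 3 ∣ BinaryQuadraticForm.classNumber (-(d : ℤ))}

/-- Yes-instances of test T3 at brightness `c`: `−d` fundamental, `d ≠ 3`, the mirror has 3-torsion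
(`#Cl₃(D⁺) ≠ 1`, tree `quadFieldThreeTorsion`), `F` bright. -/
def yesPos (c : ℝ) : Language Bool :=
  encodingNatBool.toLanguage
    {d | IsNegFundamentalDiscr d ∧ d ≠ 3 ∧ quadFieldThreeTorsion (mirrorDisc d) ≠ 1 ∧ d ∈ brightPos c}

/-- No-instances of test T3 (brightness-free): `−d` fundamental, `d ≠ 3`, `#Cl₃(D⁺) = 1`. -/
def noPos : Language Bool :=
  encodingNatBool.toLanguage {d | IsNegFundamentalDiscr d ∧ d ≠ 3 ∧ quadFieldThreeTorsion (mirrorDisc d) = 1}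

/-! ### Sanity anchors (kernel `decide`) -/

example : mirrorDisc 23 = 69 ∧ mirrorDisc 4 = 12 ∧ mirrorDisc 8 = 24 ∧ mirrorDisc 15 = 5 ∧
    mirrorDisc 24 = 8 ∧ mirrorDisc 20 = 60 ∧ mirrorDisc 84 = 28 := by decide

example : mirrorRadicand 23 = 69 ∧ mirrorRadicand 4 = 3 ∧ mirrorRadicand 8 = 6 ∧ mirrorRadicand 15 = 5 ∧
    mirrorRadicand 24 = 2 ∧ mirrorRadicand 20 = 15 ∧ mirrorRadicand 84 = 7 ∧ mirrorRadicand 87 = 29 := by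
  decide

/-! ## Registered stubs after reshape r9 (1 OPEN: S5 `stub_realIdealClassOrder` = named fact `Hallgren2007_idealClassOrder_qsolvable`; everything else is imported from the tree) — stated over TREE CONSTANTS ONLY (reshape r3: every stub
signature is vocabulary-free, so that a stub file `Theorems/ArithStatLadderIqThreeMemBQPStub*.lean` proves the
registered signature verbatim as a pure proof with no Defs import; the vocabulary above is definitionally equal to
the inlined sub-expressions and serves the composition only). The three LANDED stubs S1, S3, S7 are imported from
`Theorems/ArithStatLadderIqThreeMemBQPStub{MirrorDichotomy,FrontEnd,GuardedOr}.lean`. -/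

/-- (r7: FILED verbatim as the Literature named fact `Literature.Computability.Cryptography.Hallgren2007_idealClassOrder_qsolvable`, p106241 ACCEPTED — this stub closes by `exact Hallgren2007_idealClassOrder_qsolvable_holds` the day that lands.)
**S5 `stub_realIdealClassOrder`** (XL, HARDEST; the single
printed-not-treed quantum primitive of the whole line). The order of ONE ideal class of a real quadratic
field in quantum polynomial time WITHOUT GRH: on `⟨bin m, ⟨bin a, bin r⟩⟩`, `m ≥ 2` square-free,
`a > 0`, `a ∣ r² − m`, output `⟨bin ord[𝔞], junk⟩` for `𝔞 = (a, r + √m) ⊂ 𝒪_F`, with probability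
`≥ 2/3`. In print: Hallgren 2005 (STOC) §4 / 2007 (J. ACM) §6 — the function `(k, t) ↦` (reduced ideal
in the class of `𝔞ᵏ` at distance `t`, discretised) on `ℤ × ℝ` hides the rank-2 lattice of covolume
`ord[𝔞]·R_F`; Fourier sampling + the regulator FIRST (tree, PROVED:
`Hallgren2007_regulator_qsolvable_delim_holds`; bricks `InfrastructureNavigation`, `HallgrenCombTable`,
`PeriodFindingTwoSamples`, `IrrationalPeriodRecovery` are the `k = 0` slice). GRH enters Hallgren's
CLASS-GROUP theorem only to make poly(log Δ) primes GENERATE (Childs–van Dam 2010 §5.7). Why it might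
fail: not mathematically; formally the heaviest stub (a 2-dimensional continuous HSP).
[cite: Hallgren2005] [cite: Hallgren2007] [cite: ChildsVandam2010, §5.7] [cite: BiasseSong2015] -/
theorem stub_realIdealClassOrder :
    IsQSolvable fun x : List Bool =>
      {y | ∀ (F : Type) [Field F] [NumberField F] (m a r : ℕ) (α : 𝓞 F),
        x = boolPair (encodeNat m) (boolPair (encodeNat a) (encodeNat r)) →
          Squarefree m → 2 ≤ m → Module.finrank ℚ F = 2 → (α : F) ^ 2 = (m : F) → 0 < a →
            (a : ℤ) ∣ (r : ℤ) ^ 2 - m →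
              ∀ hI : Ideal.span {(a : 𝓞 F), (r : 𝓞 F) + α} ∈ (Ideal (𝓞 F))⁰,
                ∃ t : List Bool, y = boolPair (encodeNat (orderOf (ClassGroup.mk0 ⟨_, hI⟩))) t} := by
  sorry

/-! ## Composition (sorry-free): the arithmetic of the mirror triple test -/

/-- A code word outside the exception table `bin [0, d₁)` encodes a number `≥ d₁`. -/
theorem le_of_not_mem_table {d₁ d : ℕ}
    (h : encodingNatBool.encode d ∉ (Finset.range d₁).image encodingNatBool.encode) : d₁ ≤ d := by
  by_contra hlt
  exact h (Finset.mem_image.2 ⟨d, Finset.mem_range.2 (not_le.mp hlt), rfl⟩)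

/-- **The composition over the seven stub STATEMENTS of r1–r4** (S4 = S4b ∘ S4a ∘ S8, S6 = S6b S6a S5 after r5) (kernel-checked, no `sorry` of its own): the
guard `FUND`, the unit-cube promise problem `(cubeYes, cubeNo)` and the two torsion-witness promise problems at the
dichotomy's brightness constant cover `IQ3` and its complement outside the finite table `d < max d₀ 4` —
YES side: `d ∈ IQ3`, not a T1-cube ⇒ (S2 c) `#Cl₃(D⁺) ≠ 1` ⇒ (S1) `d ∈ yesNeg c ∪ yesPos c`;
NO side: `d ∉ IQ3` fundamental ⇒ `#Cl₃(−d) = 1` ⇒ (S2 b) not a cube and (S2 a) `#Cl₃(D⁺) = 1`. -/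
theorem iqThree_mem_BQP_of_parts
    (h1 : ∃ c : ℝ, 0 < c ∧ ∃ d₀ : ℕ, ∀ d : ℕ, d₀ ≤ d → IsNegFundamentalDiscr d → d ∈ brightNeg c ∨ d ∈ brightPos c)
    (h2a : ∀ d : ℕ, IsNegFundamentalDiscr d → quadFieldThreeTorsion (mirrorDisc d) ≠ 1 →
        3 ∣ BinaryQuadraticForm.classNumber (-(d : ℤ)))
    (h2 : ∀ d : ℕ, IsNegFundamentalDiscr d → d ≠ 3 → quadFieldThreeTorsion (mirrorDisc d) = 1 →
        3 ∣ BinaryQuadraticForm.classNumber (-(d : ℤ)) → UnitCubeAtThree d)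
    (h3 : fundLang ∈ BQP ∧ (⟨cubeYes, cubeNo⟩ : PromiseProblem) ∈ PromiseBQP)
    (h4 : ∀ c : ℝ, 0 < c → (⟨yesNeg c, noNeg⟩ : PromiseProblem) ∈ PromiseBQP)
    (h6 : ∀ c : ℝ, 0 < c → (⟨yesPos c, noPos⟩ : PromiseProblem) ∈ PromiseBQP)
    (h7 : ∀ (L G : Language Bool) (Q₁ Q₂ Q₃ : PromiseProblem) (E : Finset (List Bool)),
        G ∈ BQP → Q₁ ∈ PromiseBQP → Q₂ ∈ PromiseBQP → Q₃ ∈ PromiseBQP →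
        (∀ w, w ∉ E → w ∈ L → w ∈ G ∧ (w ∈ Q₁.yes ∨ w ∈ Q₂.yes ∨ w ∈ Q₃.yes)) →
        (∀ w, w ∉ E → w ∉ L → w ∉ G ∨ (w ∈ Q₁.no ∧ w ∈ Q₂.no ∧ w ∈ Q₃.no)) →
          L ∈ BQP) :
    iqThreeLang ∈ BQP := by
  obtain ⟨c, hc, d₀, hdich⟩ := h1
  refine h7 iqThreeLang fundLang ⟨cubeYes, cubeNo⟩ ⟨yesNeg c, noNeg⟩ ⟨yesPos c, noPos⟩
    ((Finset.range (max d₀ 4)).image encodingNatBool.encode) h3.1 h3.2 (h4 c hc) (h6 c hc) ?_ ?_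
  · -- YES side: members of `IQ3` outside the table
    intro w hwE hwL
    obtain ⟨d, hdS, rfl⟩ := hwL
    obtain ⟨hfund, h3dvd⟩ := hdS
    have hd₁ : max d₀ 4 ≤ d := le_of_not_mem_table hwE
    have hd₀ : d₀ ≤ d := le_trans (le_max_left _ _) hd₁
    have hd3 : d ≠ 3 := by
      have : 4 ≤ d := le_trans (le_max_right _ _) hd₁
      omega
    refine ⟨(encodingNatBool.mem_toLanguage_iff _ d).2 hfund, ?_⟩
    by_cases hprim : UnitCubeAtThree d
    · exact Or.inl ((encodingNatBool.mem_toLanguage_iff _ d).2 ⟨hfund, hd3, hprim⟩)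
    · right
      have hrF : quadFieldThreeTorsion (mirrorDisc d) ≠ 1 := fun h1' => hprim (h2 d hfund hd3 h1' h3dvd)
      rcases hdich d hd₀ hfund with hB | hB
      · exact Or.inl ((encodingNatBool.mem_toLanguage_iff _ d).2 ⟨hfund, h3dvd, hB⟩)
      · exact Or.inr ((encodingNatBool.mem_toLanguage_iff _ d).2 ⟨hfund, hd3, hrF, hB⟩)
  · -- NO side: non-members outside the table
    intro w hwE hwL
    by_cases hG : w ∈ fundLang
    · right
      obtain ⟨d, hfund, rfl⟩ := hG
      have hd₁ : max d₀ 4 ≤ d := le_of_not_mem_table hwE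
      have hd3 : d ≠ 3 := by
        have : 4 ≤ d := le_trans (le_max_right _ _) hd₁
        omega
      have hndvd : ¬ 3 ∣ BinaryQuadraticForm.classNumber (-(d : ℤ)) := fun h3 =>
        hwL ((encodingNatBool.mem_toLanguage_iff _ d).2 ⟨hfund, h3⟩)
      refine ⟨?_, ?_, ?_⟩
      · -- `bin d ∈ cubeNo`: a cube unit would force `3 ∣ h(−d)` (Scholz–Hecke (i), tree theorem)
        exact (encodingNatBool.mem_toLanguage_iff _ d).2
          ⟨hfund, hd3, fun hp => hndvd (ScholzHecke.cube_imp_three_dvd hfund hd3 hp)⟩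
      · exact (encodingNatBool.mem_toLanguage_iff _ d).2 ⟨hfund, hndvd⟩
      · -- `bin d ∈ noPos`: mirror `3`-torsion would force `3 ∣ h(−d)` (rank-one Scholz left)
        refine (encodingNatBool.mem_toLanguage_iff _ d).2 ⟨hfund, hd3, ?_⟩
        by_contra hne
        exact hndvd (h2a d hfund hne)
    · exact Or.inl hG

/-- **The skeleton concludes the crux BY NAME**: `ArithStatLadder.IqThreeMemBQP`
(stmt-QuantumAdvantage-2424) from the LANDED stubs S1 S3 S4a S4b S6b S7 (namespace `StubThm` :=
`Summit.QuantumAdvantage.QuantumAdvantage.Theorems.ArithStatLadder.IqThreeMemBQP`), the tree theorems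
`Hallgren2005.subgroupOrder_qsolvable_holds` (S8), `ScholzHecke.cube_imp_three_dvd` (S2(b)) and
`AvgFaceBeyondPrior.Mirror.stub_mirrorTorsionImpThreeDvd` (S2(a)), `ScholzHecke.three_dvd_imp_cube` (S2′ = direction (ii)),
the landed stubs S6a `stub_redIdealsPerClass` and S7 `stub_guardedOr`, and the ONE open stub S5 `stub_realIdealClassOrder`
(no hypotheses; the only `sorry` of the file is inside S5). -/
theorem IqThreeMemBQP_of :
    Summit.QuantumAdvantage.QuantumAdvantage.Theses.ArithStatLadder.IqThreeMemBQP :=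
  iqThreeMemBQP_iff.2 (iqThree_mem_BQP_of_parts StubThm.stub_mirrorDichotomy
    (fun d hd => Summit.QuantumAdvantage.QuantumAdvantage.Theorems.AvgFaceBeyondPrior.Mirror.stub_mirrorTorsionImpThreeDvd d hd)
    (fun _ hd => ScholzHecke.three_dvd_imp_cube hd)
    StubThm.stub_frontEnd
    (StubThm.stub_imagWitnessOfBit (StubThm.stub_threeOrdBit Hallgren2005.subgroupOrder_qsolvable_holds))
    (StubThm.stub_realWitnessOfParts StubThm.stub_redIdealsPerClass stub_realIdealClassOrder) StubThm.stub_guardedOr)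


end Summit.QuantumAdvantage.QuantumAdvantage.Cruxes.IqThreeMemBQP.ScholzMirrorSiegel

end
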